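import Summits.BirchSwinnertonDyer.Rank1Residual.X11a.SelmerCompanionAgreeShapes
import HarnessLib

/-!
# Route (3e) SELMER COMPANION, XXVIII: the abstract-agreement shapes with the RESIDUE-FIELD
# certificate (class X11a = N7; cell `b2b-bsdres`, unit `b2b-bsdres-x11a`, gen 30)

HONEST FRAMING (run/shared/lean/b2b/bsd-rank1-residual/, verbatim in every file): the goal of the
cell is to DELETE the COMBINATION-SHAPED residual classes of the Birch–Swinnerton-Dyer formula for
ALL analytic-rank `≤ 1` elliptic curves over `ℚ` — "full BSD formula for every rank `≤ 1` curve in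
class `C`" assembled STRICTLY from published theorems — so that the rank-`≤ 1` remainder becomes
exactly the CONSTRUCTION-SHAPED classes, which are TYPED (missing-input `Prop`s), NOT attempted.
This is not "finishing BSD". CLASS-OWNERS.md: research routes; NO CLAIM BEYOND STATED CLASSES.
THEOREMS ONLY; nothing booked; no label moves. CONDITIONAL on the PUBLISHED binders GZK (`hGZK`),
Cassels–Tate (`hCT`), Tate uniformisation (`hU2` = A41), Tate's local Euler characteristic (`hEP`,
Milne *ADT* I Thm. 2.8; discharged in the tree), and on the per-pair finite data named.

## What this file proves

The two booking shapes the census uses for a CLOSED RANK-ONE partner `A` — shape E (strict at the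
place of `p`: `E` multiplicative, `A` good at `p`) and shape D (strict at a killing place `v₀ ∋ ℓ₀`,
`ℓ₀ ≠ p`, where `A` is good) — in their final per-pair form:

* agreement at the places of `S \ T` as the ABSTRACT hypothesis `hagree` of file XXVII (each place
  discharged by a kind lemma of files I, IV, VIII, XI-b, XXVI — the census names the kind);
* strictness from the RESIDUE-FIELD certificate of file XXIII on a rational point `g ∈ A(ℚ)`:
  `#Ã(𝔽_ℓ) = p·n` and `n • red₀ g ≠ 0` for the tree's reduction map `red₀` of the minimal model of
  `A` at the strict place (`hred₀`), read in `Ã(ℤ/ℓ)` by file XXV.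

`bsdp_of_bsdp_partner_of_residue_certificate_at_p_agree` (shape E) and
`bsdp_of_bsdp_partner_of_residue_certificate_away_agree` (shape D): `BSD(A,p) ⟹ BSD(E,p)`.
Inputs of a booking: `BSD(A,p)` (ledger), `r_an(A) = 1`, `p ∤ #Ш_an(A)`, `A[p]` irreducible,
`r_an(E) = 0`, `p ∤ #Ш_an(E)`, `E[p]` irreducible, C1 (`θ`), the place data, the two integers and
the finite check. Not a class theorem; nothing booked.

References: files II, XXI–XXVII; [SilvermanAEC2009] VII.2.1, VIII.§2, X.§4; [MazurRubin2004] §2.3;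
HOME/b2b-bsdres-x11a/REPORT-g30.md.
-/

set_option autoImplicit false

noncomputable section

open scoped Classical NNReal

open WeierstrassCurve Literature.NumberTheory.EllipticCurves
  Literature.NumberTheory.GaloisRepresentations Field NumberField IsDedekindDomain
  IsDedekindDomain.HeightOneSpectrum Literature.NumberTheory.EllipticCurves.FormalGroupChart
  Literature.NumberTheory.EllipticCurves.Rank1Residual
  Literature.NumberTheory.EllipticCurves.Rank1Residual.Typed

namespace Summit.BirchSwinnertonDyer.Rank1Residual.X11a.SelmerCompanion

variable (W A : WeierstrassCurve ℚ) [W.IsElliptic] [A.IsElliptic] [A.IsGloballyMinimal] (p : ℕ)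
  [hp : Fact p.Prime]

/-- **Shape E, final per-pair form: abstract agreement + residue-field certificate at `p`.**
`E = W` globally minimal of analytic rank `0`, `E[p]` irreducible, `p ∤ #Ш_an(E)`, MULTIPLICATIVE
at `p` (`p` odd); `A` globally minimal, GOOD at `p`, CLOSED at `p` (`BSD(A,p)`) of analytic rank `1`
with `p ∤ #Ш_an(A)` and `A[p]` irreducible; `θ : E[p] ≃ A[p]` (certificate C1); `S ⊇ T`,
`v₀ = (p) ∈ S \ T`; at every place of `S \ (T ∪ {v₀})` kind (i) or `θ_* 𝓢_v(E) ≤ 𝓢_v(A)`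
(`hagree`); a rational point `g ∈ A(ℚ)` with `#Ã(𝔽_p) = reductionPointCount A p = p·n` and
`n • red₀ g ≠ 0`; budget `p · ∏_{v∈T} #E(ℚ_v)[p]·#(ℤ_v/p) ≤ p`. Then `BSD(E,p)`: files XXVII
(`bsdp_of_selmerCompanion_agree_strict_at_p`), XXI (`strict_at_p_of_kummerClass`), XXIII
(`hcert_of_residue_certificate`). Binders GZK, Cassels–Tate, A41, Milne I.2.8. Not a class theorem;
nothing booked. [cite: Miller2011LMS, §1 and Def. 1.1] [cite: MazurRubin2004, §2.3]
[cite: SilvermanAEC2009, Prop. VII.2.1, VIII.§2, X.§4 diagram (**), Thm X.4.2]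
[cite: GreenbergLNM1716, §2 p. 70 and Props. 2.2, 2.4] [cite: MilneADT2006, Ch. I §2 Thm. 2.8] -/
theorem bsdp_of_bsdp_partner_of_residue_certificate_at_p_agree [W.IsGloballyMinimal]
    (hU2 : Silverman1994_thmV53_corV54_tateUniformisation.{0})
    (hEP : ∀ v : HeightOneSpectrum (𝓞 ℚ), (p : 𝓞 ℚ) ∈ v.asIdeal →
      localEulerPoincareCharacteristic (v.adicCompletion ℚ))
    (hGZK : rank_eq_analyticRank_of_analyticRank_le_one)
    (hCT : exists_casselsTate_pairing (K := ℚ)) (hp2 : p ≠ 2)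
    (hr : W.analyticRank = 0) (hirr : Irr W p) (hSha : X11a.ShaAnUnit W p)
    (hbsdA : BSDp A p) (hrA : A.analyticRank = 1) (hirrA : Irr A p) (hShaA : X11a.ShaAnUnit A p)
    (θ : geomTorsion W (p : ℤ) ≃+ geomTorsion A (p : ℤ))
    (hθ : ∀ (σ : absoluteGaloisGroup ℚ) (P : geomTorsion W (p : ℤ)), θ (σ • P) = σ • θ P)
    (S T : Finset (HeightOneSpectrum (𝓞 ℚ))) (hTS : T ⊆ S)
    (hS : ∀ v : HeightOneSpectrum (𝓞 ℚ), v ∉ S →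
      A.HasGoodReductionAt v ∧ W.HasGoodReductionAt v ∧ (p : 𝓞 ℚ) ∉ v.asIdeal)
    {v₀ : HeightOneSpectrum (𝓞 ℚ)} (hpv₀ : (p : 𝓞 ℚ) ∈ v₀.asIdeal) (hv₀S : v₀ ∈ S) (hv₀T : v₀ ∉ T)
    (hmult : W.HasMultiplicativeReductionAtPrime p) (hA₀ : A.HasGoodReductionAtPrime p)
    (hagree : ∀ v ∈ S, v ∉ T → v ≠ v₀ →
      ((p : 𝓞 ℚ) ∉ v.asIdeal ∧ Nat.card (nsmulAddMonoidHom p :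
          (W.baseChange (v.adicCompletion ℚ)).toAffine.Point →+ _).ker = 1) ∨
      (∀ c ∈ selmerLocalKer W (v.adicCompletion ℚ) (p : ℤ),
        h1Equiv θ hθ c ∈ selmerLocalKer A (v.adicCompletion ℚ) (p : ℤ)))
    {w : Valuation (AlgebraicClosure (v₀.adicCompletion ℚ)) ℝ≥0}
    (hw : ∀ x, (w x : ℝ) =
      spectralNorm (v₀.adicCompletion ℚ) (AlgebraicClosure (v₀.adicCompletion ℚ)) x)
    (red₀ : localPoints A (v₀.adicCompletion ℚ) →+
      (((integralModelInt A).map (algebraMap ℤ ↥w.valuationSubring)).map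
        (IsLocalRing.residue ↥w.valuationSubring)).toAffine.Point)
    (hred₀ : ∀ P : localPoints A (v₀.adicCompletion ℚ), red₀ P =
      ((integralModelInt A).map (algebraMap ℤ ↥w.valuationSubring)).reducePoint
        (Affine.Point.congrEquiv (localIntModel_baseChange A w.valuationSubring).symm P))
    (g : A.toAffine.Point) {n : ℕ} (hn : reductionPointCount A p = p * n)
    (hg : n • red₀ (pointsMap A (v₀.adicCompletion ℚ) (toGeomPoints A g)) ≠ 0)
    (hbudget : p * ∏ v ∈ T, (Nat.card (nsmulAddMonoidHom p :
        (W.baseChange (v.adicCompletion ℚ)).toAffine.Point →+ _).ker *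
          Nat.card (v.adicCompletionIntegers ℚ ⧸
            Ideal.span {(p : v.adicCompletionIntegers ℚ)})) ≤ p) :
    BSDp W p := by
  have hpp : p.Prime := hp.out
  have hn0 : (p : ℤ) ≠ 0 := by exact_mod_cast hpp.ne_zero
  haveI hV : (A.baseChange (AlgebraicClosure (v₀.adicCompletion ℚ))).IsIntegral w.integer :=
    ⟨⟨(integralModelInt A).map (algebraMap ℤ ↥w.integer),
      A.baseChange_eq_localIntModel_integer_baseChange⟩⟩
  have hΔ : ¬ (p : ℤ) ∣ minimalDiscriminantInt A :=
    A.not_dvd_minimalDiscriminantInt_of_hasGoodReductionAtPrime' p hA₀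
  -- `#Sel^(p)(A) = p` for the closed rank-one partner
  have hSel : Nat.card (A.selmerGroup (p : ℤ)) = p := by
    rw [natCard_selmerGroup_eq_pow_of_bsdp A p hbsdA hShaA hirrA, hrA, pow_one]
  -- the Kummer class of a `p`-th root of `g` lies in `Sel^(p)(A)`
  have hdiv : ∀ P : geomPoints A, ∃ Q : geomPoints A, (p : ℤ) • Q = P :=
    fun P ↦ A.zsmul_geomPoints_surjective_of_charZero hn0 P
  have hs : kummerClassTorsion A (p : ℤ) (zsmulRoot A (p : ℤ) hdiv g)
      (zsmul_zsmulRoot_mem A (p : ℤ) hdiv g) ∈ A.selmerGroup (p : ℤ) := by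
    have h : kummerMapTorsion A (p : ℤ) hdiv g ∈ A.selmerGroup (p : ℤ) :=
      (mem_selmerGroup_iff A _ _).mpr
        ⟨fun v ↦ kummerMapTorsion_mem_selmerLocalKer A (p : ℤ) hdiv (v.adicCompletion ℚ) g,
          fun w' ↦ kummerMapTorsion_mem_selmerLocalKer A (p : ℤ) hdiv w'.Completion g⟩
    rw [kummerMapTorsion_apply] at h
    exact h
  have hcert := hcert_of_residue_certificate A hpv₀ hw (A.isUnit_Δ_localIntModel hpv₀ hw hΔ)
    red₀ hred₀ hn hg
  exact bsdp_of_selmerCompanion_agree_strict_at_p W A p hU2 hEP hGZK hCT hp2 hr hirr hSha θ hθ S T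
    hTS hS hpv₀ hv₀S hv₀T hmult hA₀ hagree hw
    (fun ψ hψ b hb hbk ↦ strict_at_p_of_kummerClass A p hSel (zsmul_zsmulRoot_mem A (p : ℤ) hdiv g)
      hs (fun c hc ↦ hcert c (by rw [hc, zsmul_zsmulRoot])) ψ hψ b hb hbk) hbudget

/-- **Shape D, final per-pair form: abstract agreement + residue-field certificate at a killing
place `v₀ ∋ ℓ₀`, `ℓ₀ ≠ p`, where `A` is good.** As `bsdp_of_selmerCompanion_agree_kill` (file
XXVII: `hkill` describes the strict place — file XIV at a SPLIT multiplicative level-lowering place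
of `E` with `p ∤ ℓ₀ − 1`), with the injectivity of `Sel^(p)(A) → H¹(ℚ_{v₀}, A[p])` DERIVED for the
closed rank-one partner (`BSD(A,p)`, `r_an(A) = 1`, `p ∤ #Ш_an(A)`, `A[p]` irreducible) from the
residue certificate at `ℓ₀`: `#Ã(𝔽_{ℓ₀}) = reductionPointCount A ℓ₀ = p·n` and `n • red₀ g ≠ 0`
(files XXII `strict_away_of_generator_certificate`, XXIII `not_zsmul_of_residue_certificate`).
Budget `∏_{v∈T} #E(ℚ_v)[p]·#(ℤ_v/p) ≤ p`. Binders GZK, Cassels–Tate. Not a class theorem;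
nothing booked. [cite: Miller2011LMS, §1 and Def. 1.1] [cite: MazurRubin2004, §2.3]
[cite: SilvermanAEC2009, Prop. VII.2.1, VIII.§2, X.§4 diagram (**), Thm X.4.2]
[cite: GreenbergLNM1716, §2 p. 70] -/
theorem bsdp_of_bsdp_partner_of_residue_certificate_away_agree
    (hGZK : rank_eq_analyticRank_of_analyticRank_le_one)
    (hCT : exists_casselsTate_pairing (K := ℚ)) (hp2 : p ≠ 2)
    (hr : W.analyticRank = 0) (hirr : Irr W p) (hSha : X11a.ShaAnUnit W p)
    (hbsdA : BSDp A p) (hrA : A.analyticRank = 1) (hirrA : Irr A p) (hShaA : X11a.ShaAnUnit A p)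
    (θ : geomTorsion W (p : ℤ) ≃+ geomTorsion A (p : ℤ))
    (hθ : ∀ (σ : absoluteGaloisGroup ℚ) (P : geomTorsion W (p : ℤ)), θ (σ • P) = σ • θ P)
    (S T : Finset (HeightOneSpectrum (𝓞 ℚ))) (hTS : T ⊆ S)
    (hS : ∀ v : HeightOneSpectrum (𝓞 ℚ), v ∉ S →
      A.HasGoodReductionAt v ∧ W.HasGoodReductionAt v ∧ (p : 𝓞 ℚ) ∉ v.asIdeal)
    (hagree : ∀ v ∈ S, v ∉ T →
      ((p : 𝓞 ℚ) ∉ v.asIdeal ∧ Nat.card (nsmulAddMonoidHom p :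
          (W.baseChange (v.adicCompletion ℚ)).toAffine.Point →+ _).ker = 1) ∨
      (∀ c ∈ selmerLocalKer W (v.adicCompletion ℚ) (p : ℤ),
        h1Equiv θ hθ c ∈ selmerLocalKer A (v.adicCompletion ℚ) (p : ℤ)))
    {v₀ : HeightOneSpectrum (𝓞 ℚ)}
    (hkill : ∀ c ∈ selmerLocalKer W (v₀.adicCompletion ℚ) (p : ℤ),
      h1Equiv θ hθ c ∈ selmerLocalKer A (v₀.adicCompletion ℚ) (p : ℤ) →
      galoisCohomology.res (A.torsionGaloisModule (p : ℤ)) (v₀.adicCompletion ℚ) 1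
        (h1Equiv θ hθ c) = 0)
    {ℓ₀ : ℕ} [Fact ℓ₀.Prime] (hℓv₀ : (ℓ₀ : 𝓞 ℚ) ∈ v₀.asIdeal) (hAℓ : A.HasGoodReductionAtPrime ℓ₀)
    {w : Valuation (AlgebraicClosure (v₀.adicCompletion ℚ)) ℝ≥0}
    (hw : ∀ x, (w x : ℝ) =
      spectralNorm (v₀.adicCompletion ℚ) (AlgebraicClosure (v₀.adicCompletion ℚ)) x)
    (red₀ : localPoints A (v₀.adicCompletion ℚ) →+
      (((integralModelInt A).map (algebraMap ℤ ↥w.valuationSubring)).map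
        (IsLocalRing.residue ↥w.valuationSubring)).toAffine.Point)
    (hred₀ : ∀ P : localPoints A (v₀.adicCompletion ℚ), red₀ P =
      ((integralModelInt A).map (algebraMap ℤ ↥w.valuationSubring)).reducePoint
        (Affine.Point.congrEquiv (localIntModel_baseChange A w.valuationSubring).symm P))
    (g : A.toAffine.Point) {n : ℕ} (hn : reductionPointCount A ℓ₀ = p * n)
    (hg : n • red₀ (pointsMap A (v₀.adicCompletion ℚ) (toGeomPoints A g)) ≠ 0)
    (hbudget : ∏ v ∈ T, (Nat.card (nsmulAddMonoidHom p :
        (W.baseChange (v.adicCompletion ℚ)).toAffine.Point →+ _).ker *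
          Nat.card (v.adicCompletionIntegers ℚ ⧸
            Ideal.span {(p : v.adicCompletionIntegers ℚ)})) ≤ p) :
    BSDp W p := by
  have hpp : p.Prime := hp.out
  have hn0 : (p : ℤ) ≠ 0 := by exact_mod_cast hpp.ne_zero
  haveI hV : (A.baseChange (AlgebraicClosure (v₀.adicCompletion ℚ))).IsIntegral w.integer :=
    ⟨⟨(integralModelInt A).map (algebraMap ℤ ↥w.integer),
      A.baseChange_eq_localIntModel_integer_baseChange⟩⟩
  have hΔ : ¬ (ℓ₀ : ℤ) ∣ minimalDiscriminantInt A :=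
    A.not_dvd_minimalDiscriminantInt_of_hasGoodReductionAtPrime' ℓ₀ hAℓ
  have hSel : Nat.card (A.selmerGroup (p : ℤ)) = p := by
    rw [natCard_selmerGroup_eq_pow_of_bsdp A p hbsdA hShaA hirrA, hrA, pow_one]
  have hdiv : ∀ P : geomPoints A, ∃ Q : geomPoints A, (p : ℤ) • Q = P :=
    fun P ↦ A.zsmul_geomPoints_surjective_of_charZero hn0 P
  have hcert := not_zsmul_of_residue_certificate A hℓv₀ hw (A.isUnit_Δ_localIntModel hℓv₀ hw hΔ)
    red₀ hred₀ hn g hg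
  exact bsdp_of_selmerCompanion_agree_kill W A p hGZK hCT hp2 hr hirr hSha θ hθ S T hTS hS hagree
    hkill
    (fun d hd hd0 ↦ strict_away_of_generator_certificate A p (v₀.adicCompletion ℚ)
      (charZero_adicCompletion v₀) hSel hdiv g hcert hd hd0) hbudget

end Summit.BirchSwinnertonDyer.Rank1Residual.X11a.SelmerCompanion

end
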